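import Literature.MathematicalPhysics.QuantumLattice.ReducedBCSTorus
import Literature.MathematicalPhysics.QuantumLattice.PairCorrelationsProofs
import Literature.MathematicalPhysics.QuantumLattice.LatticeToriProofs
import Literature.Probability.LatticeModels.TorusFourierDecayFromDifferences
import HarnessLib

/-!
# Lipschitz continuity of the momentum distribution from clustering of the one-particle
# density matrix (finite torus, explicit constants)

Topic `MathematicalPhysics/QuantumLattice` (family `hubbard`); proof-only Fourier bookkeeping on the
tree's Jordan–Wigner Fock space of the fermionic torus `(ℤ/Lℤ)²`, written for route
`HubbardSuperconductivity/ParityGapRigidity` (items `GappedWindow` / `NoUniformParityGap`): there the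
sector-relative Hastings–Koma lemma (`ParityGapClustering`, proved in the tree) turns a uniform
one-particle parity gap into exponential clustering of `ρ₁`, and this file turns clustering of `ρ₁`
into the absence of any Fermi-surface discontinuity of the momentum distribution, uniformly in the
volume.

For a Fock vector `ψ` on `Orb (FermionTorus 2 L)` write `ρ₁(ψ)((x,σ),(y,σ)) = ⟨ψ, c†_{xσ} c_{yσ} ψ⟩`
(`oneParticleRDM`) and `n_σ(k) = ⟨ψ, c†_{kσ} c_{kσ} ψ⟩` (`momentumNumber`, unitarily normalised
Bloch modes `c_{kσ} = L⁻¹ Σ_x conj χ_k(x) c_{xσ}`):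

* `natAbs_valMinAbs_mul_le`, `natAbs_valMinAbs_sum_mul_le` — the cyclic absolute value
  `|a|_L = |valMinAbs a|` on `ℤ/Lℤ` is submultiplicative, so `|Σⱼ vⱼ xⱼ|_L ≤ d ‖v‖ ‖x‖` for the
  periodic sup-norms `‖·‖ = torusNorm` of `v, x ∈ (ℤ/Lℤ)^d`;
* `norm_stdAddChar_sub_one_le` — the chord bound from ABOVE `‖e(a) - 1‖ ≤ 2π|a|_L/L`
  (companion of the tree's lower chord bound `le_norm_torusChar_sub_one`);
* `norm_torusChar_sub_one_le`, `norm_torusChar_sub_torusChar_le` — hence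
  `‖χ_v(x) - 1‖ ≤ 2πd ‖v‖‖x‖/L` and `‖χ_k(x) - χ_{k'}(x)‖ ≤ 2πd · dist(k,k') · ‖x‖/L`: characters of
  nearby momenta differ by `O(‖x‖/L)`;
* `momentumNumber_eq_sum`, `expect_momentumNumber_eq_sum` —
  `n_σ(k) = L⁻² Σ_{x,y} χ_k(x - y) ρ₁((x,σ),(y,σ))`;
* `sum_torusDist_mul_exp_le` — the radial sum `Σ_u dist(x,u) e^{-m dist(x,u)} ≤ 4 Σ'_r (2r+1) r e^{-mr}`
  on `(ℤ/Lℤ)²`, uniformly in `L` (sphere counting `card_filter_torusDist_eq_le`);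
* **`norm_expect_momentumNumber_sub_le_of_clustering`** — if
  `‖ρ₁((x,σ),(y,σ))‖ ≤ C e^{-m dist(x,y)}` for all sites, then for all momenta `k, k'`
  `|n_σ(k) - n_σ(k')| ≤ (16π C S_m) · dist(k,k') / L`, `S_m = Σ'_r (2r+1) r e^{-mr}`: exponentially
  clustering states have an `L`-uniformly Lipschitz momentum distribution — in particular no jump of
  order one between neighbouring momenta (no sharp Fermi surface, no Migdal discontinuity).

Everything is proved; no definitions, no named facts. Sources: the statements are folklore Fourier
analysis on finite abelian groups (S. Friedli, Y. Velenik, *Statistical Mechanics of Lattice Systems*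
(CUP 2017) §10.4; G. Benfatto, A. Giuliani, V. Mastropietro, Ann. Henri Poincaré 7 (2006) 809, §2.1 for
the lattice fermion Fourier modes); the physical reading (a one-particle gap smooths `n(k)` on the
scale of the inverse correlation length) is standard, e.g. A. B. Migdal, Sov. Phys. JETP 5 (1957) 333.

## Mathlib / tree search

Tree (REUSED): `torusChar`, `torusChar_add_left`, `norm_torusChar`, `torusChar_sub_right`,
`torusChar_eq_stdAddChar_sum` (`TorusFourierProofs`, `TorusFourierMomentBound`,
`TorusFourierDecayFromDifferences`), `momentumAnnihilation`, `momentumCreation_eq_sum`,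
`momentumNumber`, `torusFourierWeight_mul_self` (`ReducedBCSTorus`), `expect_sum`, `expect_smul`
(`PairCorrelationsProofs`), `oneParticleRDM_apply` (`PairCorrelations`), `torusNorm`, `torusDist`,
`sum_radial_le`, `card_filter_torusDist_eq_le`, `torusDist_lt`, `torusDist_comm'` (`LatticeTori(Proofs)`),
`FermionTorus.equivTorusSite` (`HubbardModel`). Mathlib: `ZMod.valMinAbs`, `ZMod.coe_valMinAbs`,
`ZMod.natAbs_min_of_le_div_two`, `ZMod.natAbs_valMinAbs_le`, `ZMod.natAbs_valMinAbs_add_le`,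
`ZMod.valMinAbs_natAbs_eq_min`, `ZMod.stdAddChar_coe`, `Real.norm_exp_I_mul_ofReal_sub_one_le`,
`Finset.le_sum_of_subadditive`, `Real.summable_pow_mul_exp_neg_nat_mul`.
-/

noncomputable section

namespace Literature.MathematicalPhysics.QuantumLattice

open Matrix Finset Literature.Probability.LatticeModels
open scoped ComplexConjugate ComplexOrder Real

/-! ### The cyclic absolute value is submultiplicative; the chord bound from above -/

section Chord

variable {d L : ℕ} [NeZero L]

/-- **Submultiplicativity of the cyclic absolute value** `|a|_L = |valMinAbs a|` on `ℤ/Lℤ`: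
`|a b|_L ≤ |a|_L |b|_L` (the product of the minimal representatives represents `a b`, and the
minimal representative has the least absolute value). [folklore] -/
theorem natAbs_valMinAbs_mul_le (a b : ZMod L) :
    (a * b).valMinAbs.natAbs ≤ a.valMinAbs.natAbs * b.valMinAbs.natAbs := by
  rw [← Int.natAbs_mul]
  refine ZMod.natAbs_min_of_le_div_two L _ _ ?_ (ZMod.natAbs_valMinAbs_le _)
  rw [Int.cast_mul, ZMod.coe_valMinAbs, ZMod.coe_valMinAbs, ZMod.coe_valMinAbs]

omit [NeZero L] in
/-- The cyclic absolute value is subadditive over finite sums: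
`|Σᵢ f i|_L ≤ Σᵢ |f i|_L`. [folklore] -/
theorem natAbs_valMinAbs_sum_le {ι : Type*} (s : Finset ι) (f : ι → ZMod L) :
    (∑ i ∈ s, f i).valMinAbs.natAbs ≤ ∑ i ∈ s, (f i).valMinAbs.natAbs := by
  refine Finset.le_sum_of_subadditive (fun z : ZMod L => z.valMinAbs.natAbs) ?_ ?_ s f
  · simp
  · intro x y
    exact (ZMod.natAbs_valMinAbs_add_le x y).trans (Int.natAbs_add_le _ _)

/-- One coordinate of a torus vector has cyclic absolute value at most the periodic sup-norm:
`|v j|_L ≤ ‖v‖`. [folklore] -/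
theorem natAbs_valMinAbs_apply_le_torusNorm (v : TorusSite d L) (j : Fin d) :
    (v j).valMinAbs.natAbs ≤ torusNorm v := by
  rw [ZMod.valMinAbs_natAbs_eq_min]
  exact Finset.le_sup (f := fun i => min (v i).val (L - (v i).val)) (Finset.mem_univ j)

/-- **`|Σⱼ vⱼ xⱼ|_L ≤ d · ‖v‖ · ‖x‖`** for the periodic sup-norms of `v, x ∈ (ℤ/Lℤ)^d`. [folklore] -/
theorem natAbs_valMinAbs_sum_mul_le (v x : TorusSite d L) :
    (∑ j, v j * x j).valMinAbs.natAbs ≤ d * (torusNorm v * torusNorm x) := by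
  calc (∑ j, v j * x j).valMinAbs.natAbs ≤ ∑ j, (v j * x j).valMinAbs.natAbs :=
        natAbs_valMinAbs_sum_le _ _
    _ ≤ ∑ _j : Fin d, torusNorm v * torusNorm x := by
        refine Finset.sum_le_sum fun j _ => (natAbs_valMinAbs_mul_le _ _).trans ?_
        exact Nat.mul_le_mul (natAbs_valMinAbs_apply_le_torusNorm v j)
          (natAbs_valMinAbs_apply_le_torusNorm x j)
    _ = d * (torusNorm v * torusNorm x) := by
        rw [Finset.sum_const, Finset.card_univ, Fintype.card_fin, smul_eq_mul]

/-- **The chord bound from above** for the standard additive character `e(a) = e^{2πi a/L}` of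
`ℤ/Lℤ`: `‖e(a) - 1‖ ≤ 2π |a|_L / L`, `|a|_L = |valMinAbs a|` (`|e^{iθ} - 1| ≤ |θ|` with the
minimal representative). [folklore] -/
theorem norm_stdAddChar_sub_one_le (a : ZMod L) :
    ‖(ZMod.stdAddChar a : ℂ) - 1‖ ≤ 2 * π * (a.valMinAbs.natAbs : ℝ) / L := by
  have ha : (ZMod.stdAddChar a : ℂ) =
      Complex.exp (Complex.I * ((2 * π * (a.valMinAbs : ℝ) / L : ℝ) : ℂ)) := by
    conv_lhs => rw [← ZMod.coe_valMinAbs a, ZMod.stdAddChar_coe]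
    congr 1
    push_cast
    ring
  rw [ha]
  refine Real.norm_exp_I_mul_ofReal_sub_one_le.trans (le_of_eq ?_)
  rw [Real.norm_eq_abs, abs_div, abs_mul, abs_of_pos (by positivity : (0 : ℝ) < 2 * π),
    Nat.abs_cast, Nat.cast_natAbs, Int.cast_abs]

/-- **Characters of `(ℤ/Lℤ)^d` are Lipschitz in the momentum, with constant `O(‖x‖/L)`**:
`‖χ_v(x) - 1‖ ≤ 2πd ‖v‖ ‖x‖ / L`. [folklore] -/
theorem norm_torusChar_sub_one_le (v x : TorusSite d L) :
    ‖torusChar v x - 1‖ ≤ 2 * π * d * (torusNorm v * torusNorm x : ℕ) / L := by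
  rw [torusChar_eq_stdAddChar_sum]
  refine (norm_stdAddChar_sub_one_le _).trans ?_
  have hL : (0 : ℝ) < L := Nat.cast_pos.2 (Nat.pos_of_ne_zero (NeZero.ne L))
  rw [div_le_div_iff_of_pos_right hL, mul_assoc (2 * π)]
  refine mul_le_mul_of_nonneg_left ?_ (by positivity)
  exact_mod_cast natAbs_valMinAbs_sum_mul_le v x

/-- **Nearby momenta have nearby characters**: `‖χ_k(x) - χ_{k'}(x)‖ ≤ 2πd · dist(k,k') · ‖x‖ / L`
(`χ_k = χ_{k'} χ_{k-k'}`, `|χ_{k'}| = 1`, `dist(k,k') = ‖k - k'‖`). [folklore] -/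
theorem norm_torusChar_sub_torusChar_le (k k' x : TorusSite d L) :
    ‖torusChar k x - torusChar k' x‖ ≤ 2 * π * d * (torusDist k k' * torusNorm x : ℕ) / L := by
  have hk : torusChar k x = torusChar k' x * torusChar (k - k') x := by
    rw [← torusChar_add_left, add_sub_cancel]
  rw [hk, ← mul_sub_one, norm_mul, norm_torusChar, one_mul]
  exact norm_torusChar_sub_one_le (k - k') x

end Chord

/-! ### The momentum distribution as a character sum of `ρ₁` -/

section Momentum

variable {L : ℕ} [NeZero L]

/-- **`n_{kσ} = L⁻² Σ_{x,y} χ_k(x - y) c†_{xσ} c_{yσ}`** (product of the two Bloch sums;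
`χ_k(x) conj χ_k(y) = χ_k(x - y)`). [folklore] -/
theorem momentumNumber_eq_sum (k : TorusSite 2 L) (σ : Fin 2) :
    momentumNumber k σ = ∑ x : FermionTorus 2 L, ∑ y : FermionTorus 2 L,
      (torusFourierWeight 2 L * torusFourierWeight 2 L *
          torusChar k (x.toTorusSite - y.toTorusSite)) •
        (creation (orb x σ) * annihilation (orb y σ)) := by
  rw [momentumNumber, momentumCreation_eq_sum, momentumAnnihilation, Finset.sum_mul]
  refine Finset.sum_congr rfl fun x _ => ?_
  rw [Finset.mul_sum]
  refine Finset.sum_congr rfl fun y _ => ?_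
  rw [smul_mul_smul_comm, torusChar_sub_right]
  congr 1
  ring

/-- **`⟨n_{kσ}⟩_ψ = L⁻² Σ_{x,y} χ_k(x - y) ρ₁(ψ)((x,σ),(y,σ))`.** [folklore] -/
theorem expect_momentumNumber_eq_sum (k : TorusSite 2 L) (σ : Fin 2)
    (ψ : Fock (Orb (FermionTorus 2 L))) :
    expect (momentumNumber k σ) ψ = ∑ x : FermionTorus 2 L, ∑ y : FermionTorus 2 L,
      torusFourierWeight 2 L * torusFourierWeight 2 L *
          torusChar k (x.toTorusSite - y.toTorusSite) *
        oneParticleRDM ψ (orb x σ) (orb y σ) := by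
  rw [momentumNumber_eq_sum, expect_sum]
  refine Finset.sum_congr rfl fun x _ => ?_
  rw [expect_sum]
  refine Finset.sum_congr rfl fun y _ => ?_
  rw [expect_smul, oneParticleRDM_apply]

/-- The difference of two occupations as one character sum:
`⟨n_{kσ}⟩ - ⟨n_{k'σ}⟩ = L⁻² Σ_{x,y} (χ_k - χ_{k'})(x - y) ρ₁((x,σ),(y,σ))`. [folklore] -/
theorem expect_momentumNumber_sub_eq_sum (k k' : TorusSite 2 L) (σ : Fin 2)
    (ψ : Fock (Orb (FermionTorus 2 L))) :
    expect (momentumNumber k σ) ψ - expect (momentumNumber k' σ) ψ =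
      ∑ x : FermionTorus 2 L, ∑ y : FermionTorus 2 L,
        torusFourierWeight 2 L * torusFourierWeight 2 L *
            (torusChar k (x.toTorusSite - y.toTorusSite) -
              torusChar k' (x.toTorusSite - y.toTorusSite)) *
          oneParticleRDM ψ (orb x σ) (orb y σ) := by
  rw [expect_momentumNumber_eq_sum, expect_momentumNumber_eq_sum, ← Finset.sum_sub_distrib]
  refine Finset.sum_congr rfl fun x _ => ?_
  rw [← Finset.sum_sub_distrib]
  refine Finset.sum_congr rfl fun y _ => ?_
  ring

omit [NeZero L] in
/-- `‖L^{-d/2} · L^{-d/2}‖ = L⁻²` in two dimensions. [folklore] -/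
theorem norm_torusFourierWeight_mul_self_two :
    ‖torusFourierWeight 2 L * torusFourierWeight 2 L‖ = ((L : ℝ) ^ 2)⁻¹ := by
  rw [torusFourierWeight_mul_self, norm_inv, norm_pow, Complex.norm_natCast]

end Momentum

/-! ### Radial summation of `r e^{-mr}` on `(ℤ/Lℤ)²` -/

section Radial

variable {L : ℕ} [NeZero L]

/-- The profile `(2r+1) · r e^{-mr}` is summable for `m > 0`. [folklore] -/
theorem summable_profile_mul_exp {m : ℝ} (hm : 0 < m) :
    Summable fun r : ℕ => (2 * (r : ℝ) + 1) * ((r : ℝ) * Real.exp (-(m * r))) := by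
  have h2 := (Real.summable_pow_mul_exp_neg_nat_mul 2 hm).mul_left 2
  have h1 := Real.summable_pow_mul_exp_neg_nat_mul 1 hm
  have heq : (fun r : ℕ => (2 * (r : ℝ) + 1) * ((r : ℝ) * Real.exp (-(m * r)))) =
      fun r : ℕ => 2 * ((r : ℝ) ^ 2 * Real.exp (-m * r)) + (r : ℝ) ^ 1 * Real.exp (-m * r) := by
    funext r
    simp only [neg_mul]
    ring
  rw [heq]
  exact h2.add h1

/-- **Radial summation on `(ℤ/Lℤ)²`, uniformly in `L`**: for `m > 0`,
`Σ_u dist(x,u) e^{-m dist(x,u)} ≤ 4 Σ'_r (2r+1) r e^{-mr}` (spheres of radius `r` have at most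
`4(2r+1)` sites, `card_filter_torusDist_eq_le`). [folklore] -/
theorem sum_torusDist_mul_exp_le {m : ℝ} (hm : 0 < m) (x : TorusSite 2 L) :
    ∑ u : TorusSite 2 L, (torusDist x u : ℝ) * Real.exp (-(m * torusDist x u)) ≤
      4 * ∑' r : ℕ, (2 * (r : ℝ) + 1) * ((r : ℝ) * Real.exp (-(m * r))) := by
  set F : ℕ → ℝ := fun r => (r : ℝ) * Real.exp (-(m * r)) with hF
  have hF0 : ∀ r, 0 ≤ F r := fun r => mul_nonneg (Nat.cast_nonneg r) (Real.exp_nonneg _)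
  have h1 : ∑ u : TorusSite 2 L, (torusDist x u : ℝ) * Real.exp (-(m * torusDist x u)) =
      ∑ u : TorusSite 2 L, F (torusDist u x) :=
    Finset.sum_congr rfl fun u _ => by rw [torusDist_comm']
  rw [h1]
  calc ∑ u : TorusSite 2 L, F (torusDist u x)
      ≤ ∑ r ∈ range L, ((2 * (2 * (2 * r + 1) ^ (2 - 1))) : ℕ) * F r :=
        sum_radial_le F hF0 x (card_filter_torusDist_eq_le (by norm_num) x)
          (fun u => torusDist_lt u x)
    _ = 4 * ∑ r ∈ range L, (2 * (r : ℝ) + 1) * F r := by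
        rw [Finset.mul_sum]
        refine Finset.sum_congr rfl fun r _ => ?_
        push_cast
        ring
    _ ≤ 4 * ∑' r : ℕ, (2 * (r : ℝ) + 1) * F r := by
        gcongr
        exact (summable_profile_mul_exp hm).sum_le_tsum _
          (fun r _ => mul_nonneg (by positivity) (hF0 r))

end Radial

/-! ### Clustering of `ρ₁` ⇒ Lipschitz momentum distribution -/

section Lipschitz

variable {L : ℕ} [NeZero L]

/-- **Exponential clustering of the one-particle density matrix makes the momentum distribution
`L`-uniformly Lipschitz.** If `‖ρ₁(ψ)((x,σ),(y,σ))‖ ≤ C e^{-m dist(x,y)}` for all sites `x, y` of the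
torus `(ℤ/Lℤ)²` (`C ≥ 0`, `m > 0`), then for all momenta `k, k'`
`‖⟨n_{kσ}⟩_ψ - ⟨n_{k'σ}⟩_ψ‖ ≤ 16π C S_m · dist(k,k') / L`, `S_m = Σ'_r (2r+1) r e^{-mr}`.
In particular neighbouring momenta (`dist = 1`, spacing `2π/L`) carry occupations within `O(1/L)`:
no Fermi-surface (Migdal) discontinuity survives exponential clustering, uniformly in the volume.
[folklore] -/
theorem norm_expect_momentumNumber_sub_le_of_clustering {C m : ℝ} (hC : 0 ≤ C) (hm : 0 < m)
    (σ : Fin 2) (ψ : Fock (Orb (FermionTorus 2 L)))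
    (hcl : ∀ x y : FermionTorus 2 L, ‖oneParticleRDM ψ (orb x σ) (orb y σ)‖ ≤
      C * Real.exp (-(m * torusDist x.toTorusSite y.toTorusSite)))
    (k k' : TorusSite 2 L) :
    ‖expect (momentumNumber k σ) ψ - expect (momentumNumber k' σ) ψ‖ ≤
      16 * π * C * (∑' r : ℕ, (2 * (r : ℝ) + 1) * ((r : ℝ) * Real.exp (-(m * r)))) *
        torusDist k k' / L := by
  set S : ℝ := ∑' r : ℕ, (2 * (r : ℝ) + 1) * ((r : ℝ) * Real.exp (-(m * r))) with hS
  have hL : (0 : ℝ) < L := Nat.cast_pos.2 (Nat.pos_of_ne_zero (NeZero.ne L))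
  have hS0 : 0 ≤ S := tsum_nonneg fun r => mul_nonneg (by positivity)
    (mul_nonneg (Nat.cast_nonneg r) (Real.exp_nonneg _))
  -- termwise bound of the character sum
  have hterm : ∀ x y : FermionTorus 2 L,
      ‖torusFourierWeight 2 L * torusFourierWeight 2 L *
            (torusChar k (x.toTorusSite - y.toTorusSite) -
              torusChar k' (x.toTorusSite - y.toTorusSite)) *
          oneParticleRDM ψ (orb x σ) (orb y σ)‖ ≤
        ((L : ℝ) ^ 2)⁻¹ * (4 * π * torusDist k k' / L) * C *
          ((torusDist x.toTorusSite y.toTorusSite : ℝ) *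
            Real.exp (-(m * torusDist x.toTorusSite y.toTorusSite))) := by
    intro x y
    rw [norm_mul, norm_mul, norm_torusFourierWeight_mul_self_two]
    have hchar := norm_torusChar_sub_torusChar_le k k' (x.toTorusSite - y.toTorusSite)
    have hdist : torusNorm (x.toTorusSite - y.toTorusSite) =
        torusDist x.toTorusSite y.toTorusSite := rfl
    rw [hdist] at hchar
    calc ((L : ℝ) ^ 2)⁻¹ *
          ‖torusChar k (x.toTorusSite - y.toTorusSite) - torusChar k' (x.toTorusSite - y.toTorusSite)‖ *
            ‖oneParticleRDM ψ (orb x σ) (orb y σ)‖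
        ≤ ((L : ℝ) ^ 2)⁻¹ *
            (2 * π * (2 : ℕ) * ((torusDist k k' * torusDist x.toTorusSite y.toTorusSite : ℕ) : ℝ) / L) *
            (C * Real.exp (-(m * torusDist x.toTorusSite y.toTorusSite))) :=
          mul_le_mul (mul_le_mul_of_nonneg_left hchar (by positivity)) (hcl x y) (norm_nonneg _)
            (by positivity)
      _ = _ := by push_cast; ring
  -- sum the termwise bounds
  rw [expect_momentumNumber_sub_eq_sum]
  calc _ ≤ ∑ x : FermionTorus 2 L, ∑ y : FermionTorus 2 L,
        ((L : ℝ) ^ 2)⁻¹ * (4 * π * torusDist k k' / L) * C *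
          ((torusDist x.toTorusSite y.toTorusSite : ℝ) *
            Real.exp (-(m * torusDist x.toTorusSite y.toTorusSite))) := by
        refine (norm_sum_le _ _).trans (Finset.sum_le_sum fun x _ => ?_)
        exact (norm_sum_le _ _).trans (Finset.sum_le_sum fun y _ => hterm x y)
    _ = ((L : ℝ) ^ 2)⁻¹ * (4 * π * torusDist k k' / L) * C *
          ∑ x : FermionTorus 2 L, ∑ u : TorusSite 2 L,
            (torusDist x.toTorusSite u : ℝ) * Real.exp (-(m * torusDist x.toTorusSite u)) := by
        rw [Finset.mul_sum]
        refine Finset.sum_congr rfl fun x _ => ?_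
        rw [Finset.mul_sum]
        exact Equiv.sum_comp FermionTorus.equivTorusSite (fun u =>
          ((L : ℝ) ^ 2)⁻¹ * (4 * π * torusDist k k' / L) * C *
            ((torusDist x.toTorusSite u : ℝ) * Real.exp (-(m * torusDist x.toTorusSite u))))
    _ ≤ ((L : ℝ) ^ 2)⁻¹ * (4 * π * torusDist k k' / L) * C *
          ∑ _x : FermionTorus 2 L, 4 * S := by
        gcongr with x _
        exact sum_torusDist_mul_exp_le hm x.toTorusSite
    _ = 16 * π * C * S * torusDist k k' / L := by
        rw [Finset.sum_const, Finset.card_univ, nsmul_eq_mul]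
        have hcard : (Fintype.card (FermionTorus 2 L) : ℝ) = (L : ℝ) ^ 2 := by
          rw [Fintype.card_congr FermionTorus.equivTorusSite]
          simp [Fintype.card_pi, ZMod.card]
        rw [hcard]
        field_simp
        ring

/-- **Real-part form** (the occupations are real; stated for `Re` so that it composes with the
route's real inequalities): under the same clustering hypothesis,
`|Re⟨n_{kσ}⟩ - Re⟨n_{k'σ}⟩| ≤ 16π C S_m · dist(k,k') / L`. [folklore] -/
theorem abs_re_expect_momentumNumber_sub_le_of_clustering {C m : ℝ} (hC : 0 ≤ C) (hm : 0 < m)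
    (σ : Fin 2) (ψ : Fock (Orb (FermionTorus 2 L)))
    (hcl : ∀ x y : FermionTorus 2 L, ‖oneParticleRDM ψ (orb x σ) (orb y σ)‖ ≤
      C * Real.exp (-(m * torusDist x.toTorusSite y.toTorusSite)))
    (k k' : TorusSite 2 L) :
    |(expect (momentumNumber k σ) ψ).re - (expect (momentumNumber k' σ) ψ).re| ≤
      16 * π * C * (∑' r : ℕ, (2 * (r : ℝ) + 1) * ((r : ℝ) * Real.exp (-(m * r)))) *
        torusDist k k' / L := by
  rw [← Complex.sub_re]
  exact (Complex.abs_re_le_norm _).trans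
    (norm_expect_momentumNumber_sub_le_of_clustering hC hm σ ψ hcl k k')

end Lipschitz

end Literature.MathematicalPhysics.QuantumLattice
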